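import Summits.RiemannHypothesis.RiemannHypothesis.Theorems.TiltedLandingLaw421R3QuadW

/-!
# TiltedLandingLaw421R3 — lens-1 (N) `ToothNestPure`: the PURE three-body tooth law (exact algebra)

W-09 lens-1 (rh33346-lens-1 g10), typed on director-rh g29 RULING (CA953)(2) «(N) `ToothNestPure` (K/M−: quadratic-formula
children on |w − a| = y/√3 + `NestedStep`) → lens-1 g10», from the C2 desk's PRICE (L) memo §E.1 (rh-idea-2 g57,
`pub/ideators/rh-idea-2/g57/doc/PRICE-L-TwoBodyChild-C2-g57.md` fa548f4e, engines `tooth57.py`/`tooth57b.py`).  SUPPORT (K) for crux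
`TiltedLandingLaw421R` ⟨stmt-RiemannHypothesis-33346⟩, stub 2′ side (`RegUmbrellaLowS (1/10)`): `--supports … --as helper` only; proves no
stub, no crux, no law.  ONE import (tree `…R3QuadW`, home of `RhW08.QuadW.NestedStep`); NO `def`, no instance, no notation; CLOSED forms only
(`NestedStep` = the tree's closed Jensen disc; no margin-θ variant — lens-1 ACK l.9400 (iii)).

THE OBJECT.  The three-body factor of `f⁽ʲ⁾` at an upper zero `T = a + i·y` with a TOOTH (real zero) `t`:
`(z − T)(z − T̄)(z − t) = ((z − a)² + y²)(z − t)`, whose derivative is the CHILDREN QUADRATIC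
`Q(z) = 3(z − a)² − 2(t − a)(z − a) + y²` (§1, `hasDerivAt_threeBody`).  Writing `τ = t − a`:
* §2 (no hypothesis on `τ`): every NON-REAL zero `w` of `Q` has `Re w = a + τ/3`, `(Im w)² = (3y² − τ²)/9`, hence
  `(Re w − a)² + (Im w)² = y²/3` EXACTLY — the child sits on the circle of radius `y/√3` about the foot `a`, Jensen depth
  `E_T = −⅔·y²` — and `NestedStep T w` (`child_nested`); conversely a non-real child forces `τ² < 3y²` (`sq_lt_of_child`).
* §3 (`τ² < 3y²`, tooth within `√3·Im T` of `Re T`): the children exist and are non-real — the explicit upper child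
  `w₊ = (a + τ/3) + i·√(3y² − τ²)/3` with the factorisation `Q(z) = 3(z − w₊)(z − w̄₊)` (`children_of_near_tooth`), packaged as
  ★ `toothNestPure`.
* §4 (`3y² ≤ τ²`, far tooth): every zero of `Q` is real and lies strictly between `a` and `a + ⅔τ` (so between `Re T` and `t`)
  (`child_real_of_far_tooth`, `real_child_between`) — the READY side of C2's dichotomy (the nearer real child is a local minimum of
  `|three-body factor|`), recorded as algebra only.
NOT HERE (later objects of (CA953)(2), each after its own preview/price): (N′) `ToothNestLocated` (external field `|H′/H| ≤ κ/y`,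
`d ≤ 1 ∧ κ ≤ 1/2` to be priced by C2), (U) `UnionShadowTrichotomy` (tenure g20), (K) the glue into `∃ u, StTrkDQ … (j+1) u` via
`RhW08.SuccB.stTrkDQ_succ_of_nested`.  What §3 hands (N′): the centre `w₊`, the root gap `|w₊ − w̄₊| = ⅔·√(3y² − τ²)`
(`children_gap`), the depth `⅔·y²` to spend, and `Q = 3(z − w₊)(z − w̄₊)`.
HONEST LABEL: K = kernel-checked algebra about a cubic; nothing here bears on the truth of RH; RH is not proved; ⟨33346⟩/⟨33347⟩ OPEN;
typed ≠ checked ≠ landed ≠ proved.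
-/

noncomputable section

open Complex
open scoped ComplexConjugate

namespace RhW08.Lens1ToothNest

open RhW08.QuadW (NestedStep)

/-! ## §1 The three-body factor and its derivative (the children quadratic) -/

/-- `(z − T)(z − T̄) = (z − Re T)² + (Im T)²`. -/
theorem pair_factor_eq (T z : ℂ) : (z - T) * (z - conj T) = (z - T.re) ^ 2 + (T.im : ℂ) ^ 2 := by
  have hT : T = (T.re : ℂ) + (T.im : ℂ) * I := (Complex.re_add_im T).symm
  have hcT : conj T = (T.re : ℂ) - (T.im : ℂ) * I := Complex.ext (by simp) (by simp)
  rw [hcT]; nth_rewrite 1 [hT]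
  linear_combination (-(T.im : ℂ) ^ 2) * Complex.I_sq

/-- The three-body factor `(z − T)(z − T̄)(z − t) = ((z − Re T)² + (Im T)²)(z − t)`. -/
theorem threeBody_eq (T : ℂ) (t : ℝ) (z : ℂ) :
    (z - T) * (z - conj T) * (z - t) = ((z - T.re) ^ 2 + (T.im : ℂ) ^ 2) * (z - t) := by
  rw [pair_factor_eq]

/-- ★ §1 The derivative of the three-body factor is the CHILDREN QUADRATIC `3(z − a)² − 2(t − a)(z − a) + y²`. -/
theorem hasDerivAt_threeBody (T : ℂ) (t : ℝ) (z : ℂ) :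
    HasDerivAt (fun z : ℂ => ((z - T.re) ^ 2 + (T.im : ℂ) ^ 2) * (z - t))
      (3 * (z - T.re) ^ 2 - 2 * (t - T.re) * (z - T.re) + (T.im : ℂ) ^ 2) z := by
  have h1 : HasDerivAt (fun z : ℂ => (z - T.re) ^ 2 + (T.im : ℂ) ^ 2) (2 * (z - T.re)) z := by
    have h := ((hasDerivAt_id z).sub_const (T.re : ℂ)).pow 2
    simpa using h.add_const ((T.im : ℂ) ^ 2)
  have h2 : HasDerivAt (fun z : ℂ => z - t) 1 z := (hasDerivAt_id z).sub_const _
  exact (h1.mul h2).congr_deriv (by ring)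

/-- §1 `deriv` form of `hasDerivAt_threeBody`, on the product `(z − T)(z − T̄)(z − t)` itself. -/
theorem deriv_threeBody (T : ℂ) (t : ℝ) (z : ℂ) :
    deriv (fun z : ℂ => (z - T) * (z - conj T) * (z - t)) z =
      3 * (z - T.re) ^ 2 - 2 * (t - T.re) * (z - T.re) + (T.im : ℂ) ^ 2 := by
  have hfun : (fun z : ℂ => (z - T) * (z - conj T) * (z - t)) =
      fun z : ℂ => ((z - T.re) ^ 2 + (T.im : ℂ) ^ 2) * (z - t) := funext (threeBody_eq T t)
  rw [hfun]
  exact (hasDerivAt_threeBody T t z).deriv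

/-! ## §2 Every non-real child nests at depth exactly `⅔·(Im T)²` (no hypothesis on the tooth) -/

/-- §2 A non-real zero `w` of the children quadratic has `Re w = Re T + (t − Re T)/3` (imaginary part of `Q(w) = 0`). -/
theorem child_re {T w : ℂ} {t : ℝ}
    (hw : 3 * (w - T.re) ^ 2 - 2 * (t - T.re) * (w - T.re) + (T.im : ℂ) ^ 2 = 0) (hwim : w.im ≠ 0) :
    w.re = T.re + (t - T.re) / 3 := by
  have him := congrArg Complex.im hw
  simp only [sub_im, add_im, mul_im, mul_re, sq, ofReal_re, ofReal_im, sub_re, re_ofNat, im_ofNat, zero_im] at him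
  have key : w.im * (6 * (w.re - T.re) - 2 * (t - T.re)) = 0 := by
    ring_nf; ring_nf at him; linarith
  rcases mul_eq_zero.1 key with h | h
  · exact absurd h hwim
  · linarith

/-- §2 A non-real zero `w` of the children quadratic has `(Im w)² = (3(Im T)² − (t − Re T)²)/9` (real part of `Q(w) = 0`). -/
theorem child_im_sq {T w : ℂ} {t : ℝ}
    (hw : 3 * (w - T.re) ^ 2 - 2 * (t - T.re) * (w - T.re) + (T.im : ℂ) ^ 2 = 0) (hwim : w.im ≠ 0) :
    w.im ^ 2 = (3 * T.im ^ 2 - (t - T.re) ^ 2) / 9 := by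
  have hre := congrArg Complex.re hw
  have hwre := child_re hw hwim
  simp only [sub_re, add_re, mul_re, mul_im, sq, ofReal_re, ofReal_im, sub_im, re_ofNat, im_ofNat, zero_re] at hre
  rw [hwre] at hre
  ring_nf at hre
  nlinarith [hre]

/-- ★ §2 ON THE CIRCLE OF RADIUS `Im T/√3` ABOUT THE FOOT: `(Re w − Re T)² + (Im w)² = (Im T)²/3` for every non-real child. -/
theorem child_norm_sq {T w : ℂ} {t : ℝ}
    (hw : 3 * (w - T.re) ^ 2 - 2 * (t - T.re) * (w - T.re) + (T.im : ℂ) ^ 2 = 0) (hwim : w.im ≠ 0) :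
    (w.re - T.re) ^ 2 + w.im ^ 2 = T.im ^ 2 / 3 := by
  rw [child_im_sq hw hwim, child_re hw hwim]
  ring

/-- §2 The Jensen depth of a non-real child is exactly `E_T = −⅔·(Im T)²` (C2 §E.1, rows `d = 0.25 … 1.7321`). -/
theorem child_jensen_depth {T w : ℂ} {t : ℝ}
    (hw : 3 * (w - T.re) ^ 2 - 2 * (t - T.re) * (w - T.re) + (T.im : ℂ) ^ 2 = 0) (hwim : w.im ≠ 0) :
    (w.re - T.re) ^ 2 + w.im ^ 2 - T.im ^ 2 = -(2 / 3) * T.im ^ 2 := by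
  rw [child_norm_sq hw hwim]
  ring

/-- ★★ §2 `child_nested` — THE PURE TOOTH NEST: every non-real zero of the children quadratic lies in `T`'s CLOSED Jensen disc
(`RhW08.QuadW.NestedStep T w`, the tree's closed form), with room `⅔·(Im T)²` to spare. -/
theorem child_nested {T w : ℂ} {t : ℝ}
    (hw : 3 * (w - T.re) ^ 2 - 2 * (t - T.re) * (w - T.re) + (T.im : ℂ) ^ 2 = 0) (hwim : w.im ≠ 0) :
    NestedStep T w := by
  unfold NestedStep
  rw [child_norm_sq hw hwim]
  nlinarith [sq_nonneg T.im]

/-- §2 Conversely, a non-real child forces the tooth to lie within `√3·|Im T|` of `Re T`: `(t − Re T)² < 3(Im T)²`. -/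
theorem sq_lt_of_child {T w : ℂ} {t : ℝ}
    (hw : 3 * (w - T.re) ^ 2 - 2 * (t - T.re) * (w - T.re) + (T.im : ℂ) ^ 2 = 0) (hwim : w.im ≠ 0) :
    (t - T.re) ^ 2 < 3 * T.im ^ 2 := by
  have h := child_im_sq hw hwim
  have hpos : 0 < w.im ^ 2 := by positivity
  rw [h] at hpos
  linarith

/-! ## §3 Near tooth (`(t − Re T)² < 3(Im T)²`): the children exist, are non-real, and `Q = 3(z − w₊)(z − w̄₊)` -/

/-- ★★ §3 `children_of_near_tooth`: for a tooth within `√3·Im T` of `Re T`, the explicit UPPER CHILD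
`w₊ = (Re T + (t − Re T)/3) + i·√(3(Im T)² − (t − Re T)²)/3` has `0 < Im w₊` and factors the children quadratic:
`3(z − Re T)² − 2(t − Re T)(z − Re T) + (Im T)² = 3(z − w₊)(z − w̄₊)` for all `z`. -/
theorem children_of_near_tooth {T : ℂ} {t : ℝ} (hd : (t - T.re) ^ 2 < 3 * T.im ^ 2) :
    ∃ w : ℂ, w.re = T.re + (t - T.re) / 3 ∧ w.im = Real.sqrt (3 * T.im ^ 2 - (t - T.re) ^ 2) / 3 ∧ 0 < w.im ∧
      ∀ z : ℂ, 3 * (z - T.re) ^ 2 - 2 * (t - T.re) * (z - T.re) + (T.im : ℂ) ^ 2 = 3 * (z - w) * (z - conj w) := by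
  set s : ℝ := Real.sqrt (3 * T.im ^ 2 - (t - T.re) ^ 2) with hs
  have hs_pos : 0 < s := Real.sqrt_pos.2 (by linarith)
  have hs_sq : s ^ 2 = 3 * T.im ^ 2 - (t - T.re) ^ 2 := Real.sq_sqrt (by linarith)
  -- the explicit upper child, as a point of `ℂ` given by its two coordinates
  refine ⟨⟨T.re + (t - T.re) / 3, s / 3⟩, rfl, rfl, by positivity, ?_⟩
  intro z
  have hw : (⟨T.re + (t - T.re) / 3, s / 3⟩ : ℂ) = ((T.re + (t - T.re) / 3 : ℝ) : ℂ) + ((s / 3 : ℝ) : ℂ) * I :=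
    Complex.ext (by simp) (by simp)
  have hcw : conj (⟨T.re + (t - T.re) / 3, s / 3⟩ : ℂ) = ((T.re + (t - T.re) / 3 : ℝ) : ℂ) - ((s / 3 : ℝ) : ℂ) * I :=
    Complex.ext (by simp) (by simp)
  rw [hcw, hw]
  have hsC : ((s : ℂ)) ^ 2 = 3 * (T.im : ℂ) ^ 2 - ((t : ℂ) - (T.re : ℂ)) ^ 2 := by
    have h := congrArg (fun r : ℝ => (r : ℂ)) hs_sq
    push_cast at h
    exact h
  push_cast
  linear_combination ((1 : ℂ) / 3) * I ^ 2 * hsC + ((T.im : ℂ) ^ 2 - ((t : ℂ) - (T.re : ℂ)) ^ 2 / 3) * Complex.I_sq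

/-- §3 The root gap handed to (N′): `Im w₊ − Im w̄₊ = 2·Im w₊ = ⅔·√(3(Im T)² − (t − Re T)²)` (the Rouché / fixed-point scale). -/
theorem children_gap {T w : ℂ} {t : ℝ} (hw : w.im = Real.sqrt (3 * T.im ^ 2 - (t - T.re) ^ 2) / 3) :
    (w - conj w).im = 2 / 3 * Real.sqrt (3 * T.im ^ 2 - (t - T.re) ^ 2) ∧ (w - conj w).re = 0 := by
  constructor
  · simp [sub_im, Complex.conj_im, hw]; ring
  · simp [sub_re, Complex.conj_re]

/-- ★★★ `toothNestPure` — THE PURE THREE-BODY TOOTH LAW (C2 PRICE (L) §E.1): a tooth `t` within `√3·Im T` of `Re T` gives the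
three-body factor `(z − T)(z − T̄)(z − t)` an UPPER critical point `w` (`0 < Im w`, `Q(w) = 0`, `Q` = its derivative by `deriv_threeBody`)
on the circle of radius `Im T/√3` about the foot, NESTED in `T`'s closed Jensen disc (`NestedStep T w`), and `Q = 3(z − w)(z − w̄)`. -/
theorem toothNestPure {T : ℂ} {t : ℝ} (hd : (t - T.re) ^ 2 < 3 * T.im ^ 2) :
    ∃ w : ℂ, 0 < w.im ∧
      3 * (w - T.re) ^ 2 - 2 * (t - T.re) * (w - T.re) + (T.im : ℂ) ^ 2 = 0 ∧
      (w.re - T.re) ^ 2 + w.im ^ 2 = T.im ^ 2 / 3 ∧ NestedStep T w ∧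
      ∀ z : ℂ, 3 * (z - T.re) ^ 2 - 2 * (t - T.re) * (z - T.re) + (T.im : ℂ) ^ 2 = 3 * (z - w) * (z - conj w) := by
  obtain ⟨w, -, -, hpos, hfac⟩ := children_of_near_tooth hd
  have hw0 : 3 * (w - T.re) ^ 2 - 2 * (t - T.re) * (w - T.re) + (T.im : ℂ) ^ 2 = 0 := by
    rw [hfac w]; ring
  exact ⟨w, hpos, hw0, child_norm_sq hw0 hpos.ne', child_nested hw0 hpos.ne', hfac⟩

/-- §3 Corollary on the product itself: the derivative of `(z − T)(z − T̄)(z − t)` vanishes at an upper point of `T`'s closed Jensen disc. -/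
theorem exists_nested_critical_of_near_tooth {T : ℂ} {t : ℝ} (hd : (t - T.re) ^ 2 < 3 * T.im ^ 2) :
    ∃ w : ℂ, 0 < w.im ∧ deriv (fun z : ℂ => (z - T) * (z - conj T) * (z - t)) w = 0 ∧ NestedStep T w := by
  obtain ⟨w, hpos, hw0, -, hnest, -⟩ := toothNestPure hd
  exact ⟨w, hpos, by rw [deriv_threeBody]; exact hw0, hnest⟩

/-! ## §4 Far tooth (`3(Im T)² ≤ (t − Re T)²`): all children are real, strictly between `Re T` and `Re T + ⅔(t − Re T)` -/

/-- §4 With the tooth at distance `≥ √3·|Im T|` from `Re T`, every zero of the children quadratic is REAL. -/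
theorem child_real_of_far_tooth {T w : ℂ} {t : ℝ} (hfar : 3 * T.im ^ 2 ≤ (t - T.re) ^ 2)
    (hw : 3 * (w - T.re) ^ 2 - 2 * (t - T.re) * (w - T.re) + (T.im : ℂ) ^ 2 = 0) : w.im = 0 := by
  by_contra hwim
  have h := sq_lt_of_child hw hwim
  linarith

/-- §4 A REAL zero `w` of the children quadratic (with `Im T ≠ 0`) lies strictly between `Re T` and `Re T + ⅔(t − Re T)`:
`0 < (Re w − Re T)(t − Re T)` and `|Re w − Re T| < ⅔|t − Re T|` — so strictly between `Re T` and the tooth. -/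
theorem real_child_between {T w : ℂ} {t : ℝ} (hT : T.im ≠ 0) (hwim : w.im = 0)
    (hw : 3 * (w - T.re) ^ 2 - 2 * (t - T.re) * (w - T.re) + (T.im : ℂ) ^ 2 = 0) :
    0 < (w.re - T.re) * (t - T.re) ∧ |w.re - T.re| < 2 / 3 * |t - T.re| := by
  have hre := congrArg Complex.re hw
  simp only [sub_re, add_re, mul_re, mul_im, sq, ofReal_re, ofReal_im, sub_im, re_ofNat, im_ofNat, zero_re, hwim] at hre
  have hT2 : 0 < T.im * T.im := mul_self_pos.2 hT
  -- `u(3u − 2τ) = −y² < 0` with `u = Re w − Re T`, `τ = t − Re T`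
  have key : (w.re - T.re) * (3 * (w.re - T.re) - 2 * (t - T.re)) = -(T.im * T.im) := by
    ring_nf; ring_nf at hre; linarith
  have hneg : (w.re - T.re) * (3 * (w.re - T.re) - 2 * (t - T.re)) < 0 := by rw [key]; linarith
  have hprod : 0 < (w.re - T.re) * (t - T.re) := by nlinarith [sq_nonneg (w.re - T.re)]
  refine ⟨hprod, ?_⟩
  have hτ : t - T.re ≠ 0 := by
    rintro h; rw [h, mul_zero] at hprod; exact lt_irrefl _ hprod
  rcases lt_or_gt_of_ne hτ with hτneg | hτpos
  · have hu : w.re - T.re < 0 := by nlinarith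
    have h3 : 0 < 3 * (w.re - T.re) - 2 * (t - T.re) := by nlinarith
    rw [abs_of_neg hu, abs_of_neg hτneg]; linarith
  · have hu : 0 < w.re - T.re := by nlinarith
    have h3 : 3 * (w.re - T.re) - 2 * (t - T.re) < 0 := by nlinarith
    rw [abs_of_pos hu, abs_of_pos hτpos]; linarith

end RhW08.Lens1ToothNest
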